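import Mathlib
import Summits.Ventures.PercRepro2.SwOutArmThm
import Summits.Ventures.PercRepro2.SwOutArmSw
import Summits.Ventures.PercRepro2.SwOutJunction
import Summits.Ventures.PercRepro2.SwOutJunctionRegion

/-!
# The mark `o` pendant at the junction (blind cell PercRepro2, night-4 g13, 2026-08-26;
proofs/NIGHT4-G13.md §1)

A region `U ∋ h` (`l ∉ U`, no loop at `h`) with one junction `u ∈ U` — every other vertex of
`U ∖ {h, o}` carries an outside edge or no edge at all — in which the mark `o` is PENDANT at `u`
(every edge at `o` joins `o` to `u`).  Then every `Q`-configuration of every class is core-free: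
`o ∈ C_R(l)` forces a red edge at `o`, which puts `u` into `C_R(l)`, so `u ∉ C_R(h)` and `u` is no
core, and the only other candidate core is `h` (`core_eq_h_or_u`).  The arm principle gives the
rigid inequality on every class (`rigidOK_of_pendantMark`) with NO condition on the other
neighbours of `u` — g11's junction condition (every neighbour of `u` adjacent to `h`) is not
needed — hence row (SW) on every graph in which every vertex other than `l, h, o, u` is joined to
`l` and `o` is a leaf at `u` (`sw_of_pendantMark`).
-/

namespace Summit.Ventures.PercRepro2

namespace LocRows

open Hull

variable {V : Type*} {E : Type*} [Fintype E] [DecidableEq E]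

open scoped Classical

variable {ends : E → Sym2 V} {U : Set V} {ξ : Config E} {l h o u : V}

omit [Fintype E] [DecidableEq E] in
/-- A vertex of `C(l)` other than `l` carries a red edge to a vertex of `C(l)`. -/
lemma exists_red_edge_of_mem_cluster {ζ : Config E} {x : V} (hx : x ∈ cluster ends ζ l)
    (hxl : x ≠ l) : ∃ e y, ζ e = true ∧ ends e = s(x, y) ∧ y ∈ cluster ends ζ l := by
  have key : x ∈ {v | v = l ∨ ∃ e y, ζ e = true ∧ ends e = s(v, y) ∧ y ∈ cluster ends ζ l} := by
    refine mem_of_conn_of_closed (ends := ends) (ω := ζ) ?_ (Or.inl rfl) hx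
    intro a ha b hab
    obtain ⟨_, e, he, hends⟩ := openGraph_adj.1 hab
    right
    refine ⟨e, a, he, ends_swap hends, ?_⟩
    rcases ha with rfl | ⟨e', y, he', hends', hy⟩
    · exact mem_cluster_self _ _ _
    · exact mem_cluster_of_edge hy he' (ends_swap hends')
  rcases key with h' | h'
  · exact absurd h' hxl
  · exact h'

omit [Fintype E] [DecidableEq E] in
/-- When `o` is pendant at `u`, `o ∈ C_R(l)` puts `u` into `C_R(l)`. -/
lemma u_mem_cluster_l_of_pendant (ho : ∀ e, o ∈ ends e → ends e = s(u, o)) (hol : o ≠ l)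
    {ζ : Config E} (hoA : o ∈ cluster ends ζ l) : u ∈ cluster ends ζ l := by
  obtain ⟨e, y, _, hends, hy⟩ := exists_red_edge_of_mem_cluster hoA hol
  have hoe : o ∈ ends e := by rw [hends]; exact Sym2.mem_mk_left _ _
  have h' := ho e hoe
  rw [hends, Sym2.eq_iff] at h'
  rcases h' with ⟨rfl, rfl⟩ | ⟨_, rfl⟩
  · exact hy
  · exact hy

/-- **Every `Q`-configuration is core-free when `o` is pendant at the junction `u`** (every other
vertex of `U ∖ {h, o}` with an outside edge or no edge). -/
theorem coreFree_of_pendantMark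
    (hout : ∀ x ∈ U, x ≠ h → x ≠ o → x ≠ u →
      (∃ e y, ends e = s(x, y) ∧ y ∉ U) ∨ (∀ e, x ∉ ends e))
    (ho : ∀ e, o ∈ ends e → ends e = s(u, o)) (hol : o ≠ l) {ζ : Config E}
    (hζ : ζ ∈ swOutSide ends l h o U ξ) : CoreFree ends ζ h := by
  intro x hxT hxTp
  rcases core_eq_h_or_u hout hζ hxT hxTp with rfl | rfl
  · rfl
  · exfalso
    have hQ := (mem_swOutSide.1 hζ).1
    rw [mem_tgtU_iff'] at hQ
    obtain ⟨hhl, hoA, _⟩ := hQ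
    have huA : x ∈ cluster ends ζ l := u_mem_cluster_l_of_pendant ho hol hoA
    exact hhl (Or.inl (conn_trans huA (conn_symm hxT)))

/-- **The rigid inequality on every class of a junction region whose mark `o` is pendant at the
junction** (no loop at `h`). -/
theorem rigidOK_of_pendantMark (hl : l ∉ U) (hloop : ∀ e, ends e ≠ s(h, h))
    (hout : ∀ x ∈ U, x ≠ h → x ≠ o → x ≠ u →
      (∃ e y, ends e = s(x, y) ∧ y ∉ U) ∨ (∀ e, x ∉ ends e))
    (ho : ∀ e, o ∈ ends e → ends e = s(u, o)) (hol : o ≠ l) {𝓔 : Set (Set E)}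
    (h𝓔 : IsUpperSet 𝓔) :
    ((swOutSide ends l h o U ξ).filter fun ζ => redEdges ends ζ h ∈ 𝓔).card ≤
      ((swOutSide ends l h o U ξ).filter fun ζ => blueEdges ends ζ h ∈ 𝓔).card :=
  rigidOK_of_coreFree hl hloop (fun _ hζ => coreFree_of_pendantMark hout ho hol hζ) h𝓔

/-- A junction region whose mark `o` is pendant at the junction is a base region of the series
reduction. -/
theorem reducible_of_pendantMark (hl : l ∉ U) (hloop : ∀ e, ends e ≠ s(h, h))
    (hout : ∀ x ∈ U, x ≠ h → x ≠ o → x ≠ u →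
      (∃ e y, ends e = s(x, y) ∧ y ∉ U) ∨ (∀ e, x ∉ ends e))
    (ho : ∀ e, o ∈ ends e → ends e = s(u, o)) (hol : o ≠ l) : Reducible l h o ends U :=
  Reducible.base ends U fun ξ _ h𝓔 =>
    rigidOK_of_pendantMark (ξ := ξ) hl hloop hout ho hol h𝓔

/-- **Row 2′SW-ALL on every graph in which every vertex other than `l, h, o, u` is joined to `l`
and the mark `o` is a leaf at `u`** (no loop at `h`; nothing is asked of the other neighbours of
`u`). -/
theorem swAll_of_pendantMark (hlh : l ≠ h) (hloop : ∀ e, ends e ≠ s(h, h)) (hol : o ≠ l)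
    (ho : ∀ e, o ∈ ends e → ends e = s(u, o))
    (hjoin : ∀ x, x ≠ l → x ≠ h → x ≠ o → x ≠ u → ∃ e, ends e = s(x, l)) : SwAll ends l h o := by
  refine swAll_of_reducible l h o hlh (reducible_of_pendantMark (u := u) (by simp) hloop ?_ ho hol)
  intro x hx hxh hxo hxu
  obtain ⟨e, he⟩ := hjoin x (by simpa using hx) hxh hxo hxu
  exact Or.inl ⟨e, l, he, by simp⟩

/-- **Row (SW) on every graph in which every vertex other than `l, h, o, u` is joined to `l` and
the mark `o` is a leaf at `u`** (see `swAll_of_pendantMark`). -/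
theorem sw_of_pendantMark (hlh : l ≠ h) (hloop : ∀ e, ends e ≠ s(h, h)) (hol : o ≠ l)
    (ho : ∀ e, o ∈ ends e → ends e = s(u, o))
    (hjoin : ∀ x, x ≠ l → x ≠ h → x ≠ o → x ≠ u → ∃ e, ends e = s(x, l)) : Sw ends l h o :=
  sw_of_swAll ends (swAll_of_pendantMark hlh hloop hol ho hjoin)

end LocRows

end Summit.Ventures.PercRepro2
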